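import Mathlib
import Literature.NumberTheory.LFunctions.Zhang2022.TypedSection10A
import Literature.Analysis.Complex.PerronDirichletSeries
import HarnessLib

/-!
# Zhang (2022) §10, proof of Lemma 10.2, first display (p. 55): the Mellin/Perron form of `𝔳₂ⱼ(d,r)`
# (DAG node `Z22:§10.u018`) — an EDGE from the absolute convergence of `Σ_n χ(n)ξ₀ⱼ(n;d,r)n^{−s}`

Topic `Literature/NumberTheory/LFunctions/Zhang2022` (Landau–Siegel audit tree; verdict-neutral).
Y. Zhang, *Discrete mean estimates and the Landau–Siegel zero*, arXiv:2211.02515v1 (2022)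
[Zhang2022LandauSiegel] — **an unrefereed manuscript under adjudication** (D-0069 campaign, cell
`siegel-zhang`, statement-typer seat L3-t1; own-node edge). The proof of Lemma 10.2 opens
(p. 55, tex L2824): "First assume `dr ≤ P^{0.5}/T`. In view of (8.9) and (10.6), we have
`𝔳₂ⱼ(d,r) = (500/log P)·(1/2πi)∫_{(1)} [L(1+β_{j+1}+s,χ)L(1+β_{j+2}+s,χ)𝔲ⱼ(d,r;1+s)/L(1+s,χ)]
((P′₁)ˢ − 2(P′₂)ˢ + (P′₃)ˢ)(dr)⁻ˢ ds/s²`", typed (slice L3-t1, `TypedSection10A`) as the CLAIM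
`Typed.Sec10A.Step10u018 c′` (with `𝔲ⱼ` entering, as in `Skeleton.Lemma83`, as any function `U`
agreeing on `Re w > 1` with `L(w,χ)/(L(w+β_{j+1},χ)L(w+β_{j+2},χ))·Σ_nχ(n)ξ₀ⱼ(n;d,r)n^{−w}`).

PROVED here (theorem-only; no definitions, no new facts):

* `frakv2_eq_tent_sum` — the tent decomposition behind (10.6): for every modulus `D ≥ 2`, every
  `j` and `d, r ≥ 1`, `𝔳₂ⱼ(d,r) = (500/log P)(S(X₁) − 2S(X₂) + S(X₃))` with
  `S(X) = Σ_{n≤X} χ(n)ξ₀ⱼ(n;d,r)n⁻¹log(X/n)` and `X_k = P′_k/(dr)` — from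
  `f̃(u) = 500((0.504−u)⁺ − 2(0.502−u)⁺ + (0.5−u)⁺)` (the tent (2.28)); exact, unconditional.
* `frakv2_eq_lineInt` — the displayed identity EXACTLY as typed in `Step10u018`, for every modulus
  `D ≥ 2`, every `j`, `d, r ≥ 1` and every such `U`, UNDER the one hypothesis
  `Σ_n |χ(n)ξ₀ⱼ(n;d,r)|/n² < ∞` (absolute convergence of the series on `Re = 2`, which the display
  presupposes — the same hypothesis shape as the tree's `Section8PerronSteps.eq89` for (8.9); its
  proof is the cell's "(8.9) FULL" item, not restated or attempted here). Route: the tent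
  decomposition, the tree's Perron formula of order one for a Dirichlet series
  (`Literature.Analysis.Complex.integral_dirichletSeries_mul_perronPow`, `m = 1`) at the three
  points `X_k`, and `L(w,χ) ≠ 0` on `Re w > 1` (Mathlib) to read `L·L·U/L` as the series. The printed
  range `dr ≤ P^{0.5}/T` and hypothesis (A) are not used.
* `step10u018_of_summable` — hence `Step10u018 c′` follows from the eventual absolute convergence
  (for `j ∈ {1,2,3}`, `d, r ≥ 1`).

WHAT THIS FILE IS NOT: a proof of the absolute convergence itself, of (10.8)–(10.11), of Lemma 10.2,
or any claim about Theorems 1–2 of the manuscript or about Landau–Siegel zeros.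

## References

* Y. Zhang, arXiv:2211.02515v1 (2022), §10, proof of Lemma 10.2, p. 55 (tex L2824); (10.6) p. 54;
  (2.28); §8 (8.9) p. 46. [cite: Zhang2022LandauSiegel, §10 p.55]
* H. L. Montgomery, R. C. Vaughan, *Multiplicative Number Theory I*, CUP 2007, §5.1 (5.22)
  (Riesz means as line integrals). [cite: MontgomeryVaughan2007, Section 5.1 eq. 5.22]
-/

noncomputable section

open Complex Real MeasureTheory Set Filter

namespace Literature.NumberTheory.LFunctions.Zhang2022.Typed.Sec10A

open Literature.NumberTheory.LFunctions.Zhang2022.Skeleton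
open Literature.Analysis.Complex (perronPow integral_dirichletSeries_mul_perronPow
  integrable_perronPow_vertical ofReal_div_natCast_cpow)

/-! ## The tent `f̃` of (2.28) as a combination of positive parts -/

/-- **The tent identity**: `f̃(u) = 500((0.504 − u)⁺ − 2(0.502 − u)⁺ + (0.5 − u)⁺)` for every real
`u` (the three "pieces" of (2.28) recombined; this is what makes (10.6) a sum of three Perron
integrals). [cite: Zhang2022LandauSiegel, §2 (2.28); §10 (10.6) p. 54] -/
private theorem ftilde_eq_tent (u : ℝ) :
    ftilde u = 500 * (max (0.504 - u) 0 - 2 * max (0.502 - u) 0 + max (0.5 - u) 0) := by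
  unfold ftilde
  split_ifs with h1 h2
  · rw [max_eq_left (by linarith [h1.2]), max_eq_left (by linarith [h1.2]),
      max_eq_right (by linarith [h1.1])]
    ring
  · rw [max_eq_left (by linarith [h2.2]), max_eq_right (by linarith [h2.1]),
      max_eq_right (by linarith [h2.1])]
    ring
  · rw [not_and_or, not_le, not_le] at h1 h2
    rcases h1 with h1 | h1
    · rw [max_eq_left (by linarith), max_eq_left (by linarith), max_eq_left (by linarith)]
      ring
    · rcases h2 with h2 | h2
      · exact absurd h2 (not_lt.mpr h1.le)
      · rw [max_eq_right (by linarith), max_eq_right (by linarith), max_eq_right (by linarith)]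
        ring

/-- `(a − log v/log P)⁺ = log⁺(Pᵃ/v)/log P` for `P > 1`, `v > 0`, with `log⁺ x = log x` for
`x ≥ 1` and `0` otherwise. [cite: Zhang2022LandauSiegel, §10 (10.6) p. 54] -/
private theorem max_sub_eq_plog {P v : ℝ} (hP : 1 < P) (hv : 0 < v) (a : ℝ) :
    max (a - Real.log v / Real.log P) 0 =
      (if 1 ≤ P ^ a / v then Real.log (P ^ a / v) else 0) / Real.log P := by
  have hP0 : 0 < P := by linarith
  have hL : 0 < Real.log P := Real.log_pos hP
  have hPa : 0 < P ^ a := Real.rpow_pos_of_pos hP0 a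
  have hlog : Real.log (P ^ a / v) = a * Real.log P - Real.log v := by
    rw [Real.log_div hPa.ne' hv.ne', Real.log_rpow hP0]
  by_cases h : 1 ≤ P ^ a / v
  · have h0 : 0 ≤ Real.log (P ^ a / v) := Real.log_nonneg h
    rw [if_pos h, max_eq_left, hlog]
    · field_simp
    · rw [hlog] at h0
      rw [sub_nonneg, div_le_iff₀ hL]
      linarith
  · have h0 : Real.log (P ^ a / v) < 0 := Real.log_neg (div_pos hPa hv) (not_le.mp h)
    rw [if_neg h, zero_div, max_eq_right]
    rw [hlog] at h0
    rw [sub_nonpos, le_div_iff₀ hL]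
    linarith

/-- **`f̃(log(yn)/log P)` as three `log⁺`'s**: for `P > 1`, `y > 0`, `n ≥ 1`,
`f̃(log(yn)/log P) = (500/log P)(log⁺(X₁/n) − 2log⁺(X₂/n) + log⁺(X₃/n))`, `X_k = P^{a_k}/y`,
`(a₁,a₂,a₃) = (0.504, 0.502, 0.5)`. [cite: Zhang2022LandauSiegel, §10 (10.6) p. 54] -/
private theorem ftilde_log_eq {P y : ℝ} (hP : 1 < P) (hy : 0 < y) {n : ℕ} (hn : 1 ≤ n) :
    ftilde (Real.log (y * n) / Real.log P) = 500 / Real.log P *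
      ((if 1 ≤ P ^ (0.504 : ℝ) / y / n then Real.log (P ^ (0.504 : ℝ) / y / n) else 0) -
        2 * (if 1 ≤ P ^ (0.502 : ℝ) / y / n then Real.log (P ^ (0.502 : ℝ) / y / n) else 0) +
        (if 1 ≤ P ^ (0.5 : ℝ) / y / n then Real.log (P ^ (0.5 : ℝ) / y / n) else 0)) := by
  have hn0 : (0 : ℝ) < n := by exact_mod_cast hn
  have hv : 0 < y * n := mul_pos hy hn0
  rw [ftilde_eq_tent, max_sub_eq_plog hP hv, max_sub_eq_plog hP hv, max_sub_eq_plog hP hv]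
  simp only [div_div]
  ring

/-- Restricting the `n`-sum of `𝔳₂ⱼ` (`1 ≤ n < ⌈P⌉`) by the indicator `n ≤ X` (`0 ≤ X < P`) gives
the sum over `1 ≤ n ≤ ⌊X⌋`. [cite: Zhang2022LandauSiegel, §10 Lemma 10.2 p. 55] -/
private theorem sum_Ico_ite_eq_sum_Icc {P X : ℝ} (hX0 : 0 ≤ X) (hXP : X < P) (g : ℕ → ℂ) :
    ∑ n ∈ Finset.Ico 1 ⌈P⌉₊, g n * ((if 1 ≤ X / n then Real.log (X / n) else 0 : ℝ) : ℂ) =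
      ∑ n ∈ Finset.Icc 1 ⌊X⌋₊, g n * ((Real.log (X / n) : ℝ) : ℂ) := by
  have hsub : Finset.Icc 1 ⌊X⌋₊ ⊆ Finset.Ico 1 ⌈P⌉₊ := by
    intro n hn
    rw [Finset.mem_Icc] at hn
    rw [Finset.mem_Ico]
    refine ⟨hn.1, Nat.lt_ceil.mpr ?_⟩
    exact lt_of_le_of_lt (le_trans (by exact_mod_cast hn.2) (Nat.floor_le hX0)) hXP
  have hpt : ∀ n ∈ Finset.Ico 1 ⌈P⌉₊,
      g n * ((if 1 ≤ X / n then Real.log (X / n) else 0 : ℝ) : ℂ) =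
        if n ∈ Finset.Icc 1 ⌊X⌋₊ then g n * ((Real.log (X / n) : ℝ) : ℂ) else 0 := by
    intro n hn
    have hn1 : 1 ≤ n := (Finset.mem_Ico.mp hn).1
    have hn0 : (0 : ℝ) < n := by exact_mod_cast hn1
    have hiff : 1 ≤ X / n ↔ n ∈ Finset.Icc 1 ⌊X⌋₊ := by
      rw [Finset.mem_Icc, le_div_iff₀ hn0, one_mul, Nat.le_floor_iff hX0]
      exact ⟨fun h => ⟨hn1, h⟩, fun h => h.2⟩
    by_cases h : 1 ≤ X / n
    · rw [if_pos h, if_pos (hiff.mp h)]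
    · rw [if_neg h, if_neg (fun h' => h (hiff.mpr h'))]
      simp
  rw [Finset.sum_congr rfl hpt, ← Finset.sum_filter, Finset.filter_mem_eq_inter,
    Finset.inter_eq_right.mpr hsub]

/-! ## The tent decomposition of `𝔳₂ⱼ(d,r)` -/

/-- `P > 1` for `D ≥ 2` (`P = exp 𝓛⁹`, `𝓛 = log D > 0`). [cite: Zhang2022LandauSiegel, §2 (2.6)] -/
private theorem one_lt_bigP {D : ℕ} (hD : 2 ≤ D) : 1 < bigP D := by
  have hD' : (2 : ℝ) ≤ D := by exact_mod_cast hD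
  have hell : 0 < ell D := Real.log_pos (by linarith)
  rw [bigP, ← Real.exp_zero]
  exact Real.exp_lt_exp.mpr (pow_pos hell 9)

/-- **The tent decomposition of `𝔳₂ⱼ(d,r)`** (the content of "by (10.6)" for the `n`-sum of
Lemma 10.2): for every modulus `D ≥ 2`, every `j` and `d, r ≥ 1`,
`𝔳₂ⱼ(d,r) = (500/log P)·(S(X₁) − 2S(X₂) + S(X₃))`, `S(X) = Σ_{1≤n≤X} χ(n)ξ₀ⱼ(n;d,r)n⁻¹log(X/n)`,
`X_k = P′_k/(dr)` (`P′₁ = P^{0.504}`, `P′₂ = P^{0.502}`, `P′₃ = P^{0.5}`). Exact; no (A), no range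
restriction on `dr`. [cite: Zhang2022LandauSiegel, §10 (10.6) p. 54; Lemma 10.2 p. 55] -/
theorem frakv2_eq_tent_sum (c' : ℝ) {D : ℕ} [NeZero D] (χ : DirichletCharacter ℂ D) (hD : 2 ≤ D)
    (j : ℕ) {d r : ℕ} (hd : 1 ≤ d) (hr : 1 ≤ r) :
    frakv2 c' χ j d r = (500 : ℂ) / (Real.log (bigP D) : ℂ) *
      ((∑ n ∈ Finset.Icc 1 ⌊Pp1 D / ((d * r : ℕ) : ℝ)⌋₊,
          χ (n : ZMod D) * xiZero c' D j n d r / (n : ℂ) *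
            ((Real.log (Pp1 D / ((d * r : ℕ) : ℝ) / n) : ℝ) : ℂ)) -
        2 * (∑ n ∈ Finset.Icc 1 ⌊Pp2 D / ((d * r : ℕ) : ℝ)⌋₊,
          χ (n : ZMod D) * xiZero c' D j n d r / (n : ℂ) *
            ((Real.log (Pp2 D / ((d * r : ℕ) : ℝ) / n) : ℝ) : ℂ)) +
        ∑ n ∈ Finset.Icc 1 ⌊Pp3 D / ((d * r : ℕ) : ℝ)⌋₊,
          χ (n : ZMod D) * xiZero c' D j n d r / (n : ℂ) *
            ((Real.log (Pp3 D / ((d * r : ℕ) : ℝ) / n) : ℝ) : ℂ)) := by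
  have hP1 : 1 < bigP D := one_lt_bigP hD
  have hP0 : 0 < bigP D := by linarith
  have hdr : 0 < d * r := Nat.mul_pos hd hr
  have hy : 0 < ((d * r : ℕ) : ℝ) := by exact_mod_cast hdr
  set y : ℝ := ((d * r : ℕ) : ℝ) with hy_def
  -- the summand, rewritten through the tent identity
  have hterm : ∀ n ∈ Finset.Ico 1 ⌈bigP D⌉₊,
      χ (n : ZMod D) * (ftilde (Real.log ((d * r * n : ℕ) : ℝ) / Real.log (bigP D)) : ℂ) *
          xiZero c' D j n d r / (n : ℂ) =
        (500 : ℂ) / (Real.log (bigP D) : ℂ) *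
          (χ (n : ZMod D) * xiZero c' D j n d r / (n : ℂ) *
              ((if 1 ≤ Pp1 D / y / n then Real.log (Pp1 D / y / n) else 0 : ℝ) : ℂ) -
            2 * (χ (n : ZMod D) * xiZero c' D j n d r / (n : ℂ) *
              ((if 1 ≤ Pp2 D / y / n then Real.log (Pp2 D / y / n) else 0 : ℝ) : ℂ)) +
            χ (n : ZMod D) * xiZero c' D j n d r / (n : ℂ) *
              ((if 1 ≤ Pp3 D / y / n then Real.log (Pp3 D / y / n) else 0 : ℝ) : ℂ)) := by
    intro n hn
    have hn1 : 1 ≤ n := (Finset.mem_Ico.mp hn).1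
    have hcast : ((d * r * n : ℕ) : ℝ) = y * n := by rw [hy_def]; push_cast; ring
    rw [hcast, ftilde_log_eq hP1 hy hn1]
    simp only [Pp1, Pp2, Pp3, Complex.ofReal_mul, Complex.ofReal_div, Complex.ofReal_sub,
      Complex.ofReal_add, Complex.ofReal_ofNat]
    ring
  rw [frakv2, Finset.sum_congr rfl hterm, ← Finset.mul_sum, Finset.sum_add_distrib,
    Finset.sum_sub_distrib, ← Finset.mul_sum]
  -- the three windows `X_k = P′_k/(dr)` lie in `[0, P)`
  have hX : ∀ a : ℝ, a < 1 → 0 ≤ bigP D ^ a / y ∧ bigP D ^ a / y < bigP D := by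
    intro a ha
    have hPa : 0 < bigP D ^ a := Real.rpow_pos_of_pos hP0 a
    have hy1 : 1 ≤ y := by rw [hy_def]; exact_mod_cast hdr
    refine ⟨(div_pos hPa hy).le, ?_⟩
    calc bigP D ^ a / y ≤ bigP D ^ a := div_le_self hPa.le hy1
      _ < bigP D ^ (1 : ℝ) := Real.rpow_lt_rpow_of_exponent_lt hP1 ha
      _ = bigP D := Real.rpow_one _
  have h1 : 0 ≤ Pp1 D / y ∧ Pp1 D / y < bigP D := hX 0.504 (by norm_num)
  have h2 : 0 ≤ Pp2 D / y ∧ Pp2 D / y < bigP D := hX 0.502 (by norm_num)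
  have h3 : 0 ≤ Pp3 D / y ∧ Pp3 D / y < bigP D := hX 0.5 (by norm_num)
  rw [sum_Ico_ite_eq_sum_Icc h1.1 h1.2, sum_Ico_ite_eq_sum_Icc h2.1 h2.2,
    sum_Ico_ite_eq_sum_Icc h3.1 h3.2]

/-! ## The Perron side: three order-one Perron integrals of the series `Σ_n χ(n)ξ₀ⱼ(n;d,r)n^{−(1+s)}` -/

/-- The exponent `1 + (1 + it)` on the line `Re s = 1` is never `0`. [folklore] -/
private theorem one_add_line_ne_zero (t : ℝ) : (1 : ℂ) + (((1 : ℝ) : ℂ) + t * I) ≠ 0 := by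
  intro h
  have := congrArg Complex.re h
  simp at this

/-- Termwise majorant on the line `Re s = 1`: `‖a(n)n^{−(1+s)}‖ ≤ |a(n)|/n²`. [folklore] -/
private theorem norm_term_le (a : ℕ → ℂ) (t : ℝ) (n : ℕ) :
    ‖a n / (n : ℂ) ^ (1 + (((1 : ℝ) : ℂ) + t * I))‖ ≤ ‖a n‖ / (n : ℝ) ^ 2 := by
  rcases Nat.eq_zero_or_pos n with rfl | hn
  · rw [Nat.cast_zero, Complex.zero_cpow (one_add_line_ne_zero t), div_zero, norm_zero,
      Nat.cast_zero]
    positivity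
  · have hre : (1 + (((1 : ℝ) : ℂ) + t * I)).re = 2 := by simp; norm_num
    rw [norm_div, Complex.norm_natCast_cpow_of_pos hn, hre, Real.rpow_two]

/-- **`(1/2πi)∫_{(1)} F(1+s)(X₁ˢ − 2X₂ˢ + X₃ˢ) ds/s² = S(X₁) − 2S(X₂) + S(X₃)`** for the absolutely
convergent Dirichlet series `F(1+s) = Σ_n a(n)n^{−(1+s)}` (`Σ|a(n)|/n² < ∞`) and `X_k > 0`, with
`S(X) = Σ_{n≤X} a(n)n⁻¹log(X/n)`: three instances of the tree's order-one Perron formula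
(`integral_dirichletSeries_mul_perronPow`). [cite: MontgomeryVaughan2007, Section 5.1 eq. 5.22] -/
private theorem lineInt_perron_comb {a : ℕ → ℂ} (ha : Summable fun n : ℕ => ‖a n‖ / (n : ℝ) ^ 2)
    {X₁ X₂ X₃ : ℝ} (h1 : 0 < X₁) (h2 : 0 < X₂) (h3 : 0 < X₃) :
    lineInt 1 (fun s => (∑' n : ℕ, a n / (n : ℂ) ^ (1 + s)) *
        (perronPow X₁ 1 s - 2 * perronPow X₂ 1 s + perronPow X₃ 1 s)) =
      (∑ n ∈ Finset.Icc 1 ⌊X₁⌋₊, a n / (n : ℂ) * ((Real.log (X₁ / n) : ℝ) : ℂ)) -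
        2 * (∑ n ∈ Finset.Icc 1 ⌊X₂⌋₊, a n / (n : ℂ) * ((Real.log (X₂ / n) : ℝ) : ℂ)) +
        ∑ n ∈ Finset.Icc 1 ⌊X₃⌋₊, a n / (n : ℂ) * ((Real.log (X₃ / n) : ℝ) : ℂ) := by
  set G : ℝ → ℂ := fun t => ∑' n : ℕ, a n / (n : ℂ) ^ (1 + (((1 : ℝ) : ℂ) + t * I)) with hG
  -- `G` is continuous and bounded (uniformly absolutely convergent series)
  have hGc : Continuous G := by
    refine continuous_tsum (fun n => ?_) ha (fun n t => norm_term_le a t n)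
    rcases Nat.eq_zero_or_pos n with rfl | hn
    · have h0 : (fun t : ℝ => a 0 / ((0 : ℕ) : ℂ) ^ (1 + (((1 : ℝ) : ℂ) + t * I))) = fun _ => 0 := by
        funext t
        rw [Nat.cast_zero, Complex.zero_cpow (one_add_line_ne_zero t), div_zero]
      rw [h0]
      exact continuous_const
    · refine continuous_const.div (Continuous.const_cpow (by fun_prop)
        (Or.inl (by exact_mod_cast hn.ne'))) (fun t => ?_)
      rw [Ne, Complex.cpow_eq_zero_iff, not_and_or]
      exact Or.inl (by exact_mod_cast hn.ne')
  have hGb : ∀ t : ℝ, ‖G t‖ ≤ ∑' n : ℕ, ‖a n‖ / (n : ℝ) ^ 2 := by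
    intro t
    have hs : Summable fun n : ℕ => ‖a n / (n : ℂ) ^ (1 + (((1 : ℝ) : ℂ) + t * I))‖ :=
      Summable.of_nonneg_of_le (fun n => norm_nonneg _) (fun n => norm_term_le a t n) ha
    exact (norm_tsum_le_tsum_norm hs).trans (hs.tsum_le_tsum (fun n => norm_term_le a t n) ha)
  -- each product `G · (X_k^s/s²)` is integrable along the line, with the Perron value
  have hInt : ∀ {X : ℝ}, 0 < X →
      Integrable (fun t : ℝ => G t * perronPow X 1 (((1 : ℝ) : ℂ) + t * I)) := fun hX =>
    (integrable_perronPow_vertical hX le_rfl one_ne_zero).bdd_mul hGc.aestronglyMeasurable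
      (Eventually.of_forall hGb)
  have hPer : ∀ {X : ℝ}, 0 < X → ∫ t : ℝ, G t * perronPow X 1 (((1 : ℝ) : ℂ) + t * I) =
      2 * Real.pi * ∑ n ∈ Finset.Icc 1 ⌊X⌋₊, a n / (n : ℂ) * ((Real.log (X / n) : ℝ) : ℂ) := by
    intro X hX
    have h := integral_dirichletSeries_mul_perronPow ha hX (le_refl 1)
    simp only [pow_one, Nat.factorial_one, Nat.cast_one, div_one] at h
    exact h
  -- split the line integral into the three Perron integrals
  have hsplit : (fun t : ℝ => (fun s : ℂ => (∑' n : ℕ, a n / (n : ℂ) ^ (1 + s)) *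
      (perronPow X₁ 1 s - 2 * perronPow X₂ 1 s + perronPow X₃ 1 s)) (((1 : ℝ) : ℂ) + (t : ℂ) * I)) =
      fun t : ℝ => (G t * perronPow X₁ 1 (((1 : ℝ) : ℂ) + t * I) -
        2 * (G t * perronPow X₂ 1 (((1 : ℝ) : ℂ) + t * I))) +
        G t * perronPow X₃ 1 (((1 : ℝ) : ℂ) + t * I) := by
    funext t
    simp only [hG]
    ring
  have i1 : Integrable (fun t : ℝ => G t * perronPow X₁ 1 (((1 : ℝ) : ℂ) + t * I)) := hInt h1
  have i2 : Integrable (fun t : ℝ => 2 * (G t * perronPow X₂ 1 (((1 : ℝ) : ℂ) + t * I))) :=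
    (hInt h2).const_mul 2
  have i3 : Integrable (fun t : ℝ => G t * perronPow X₃ 1 (((1 : ℝ) : ℂ) + t * I)) := hInt h3
  have i12 : Integrable (fun t : ℝ => G t * perronPow X₁ 1 (((1 : ℝ) : ℂ) + t * I) -
      2 * (G t * perronPow X₂ 1 (((1 : ℝ) : ℂ) + t * I))) := i1.sub i2
  rw [lineInt, hsplit, integral_add i12 i3, integral_sub i1 i2, integral_const_mul, hPer h1, hPer h2,
    hPer h3]
  have hπ : (π : ℂ) ≠ 0 := by exact_mod_cast Real.pi_pos.ne'
  field_simp

/-! ## `Z22:§10.u018`: the display, from the absolute convergence -/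

/-- `Re β_j = 0`: the shifts (2.13) are purely imaginary. [cite: Zhang2022LandauSiegel, §2 (2.13)] -/
private theorem betaJ_re_eq_zero (c' : ℝ) (D : ℕ) (j : ℕ) : (betaJ c' D j).re = 0 := by
  unfold betaJ beta1 beta2 beta3
  split_ifs <;> simp

/-- **`Z22:§10.u018` as an identity, for every modulus** (p. 55, tex L2824): if
`Σ_n |χ(n)ξ₀ⱼ(n;d,r)|/n² < ∞`, then for `D ≥ 2`, `d, r ≥ 1` and every `U` agreeing on `Re w > 1` with
`L(w,χ)/(L(w+β_{j+1},χ)L(w+β_{j+2},χ))·Σ_nχ(n)ξ₀ⱼ(n;d,r)n^{−w}`,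
`𝔳₂ⱼ(d,r) = (500/log P)·(1/2πi)∫_{(1)} [L(1+β_{j+1}+s,χ)L(1+β_{j+2}+s,χ)U(1+s)/L(1+s,χ)]
((P′₁)ˢ − 2(P′₂)ˢ + (P′₃)ˢ)(dr)⁻ˢ ds/s²` — "in view of (8.9) and (10.6)": on the line the bracket is
the series itself (`L ≠ 0` on `Re w > 1`), `f̃` splits into three `log⁺` (tent decomposition), and
each piece is an order-one Perron integral. (A) and the range `dr ≤ P^{0.5}/T` are not needed.
[cite: Zhang2022LandauSiegel, §10 proof of Lemma 10.2 p. 55, tex L2824] -/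
theorem frakv2_eq_lineInt (c' : ℝ) {D : ℕ} [NeZero D] (χ : DirichletCharacter ℂ D) (hD : 2 ≤ D)
    {j d r : ℕ} (hd : 1 ≤ d) (hr : 1 ≤ r)
    (hξ : Summable fun n : ℕ => ‖χ (n : ZMod D) * xiZero c' D j n d r‖ / (n : ℝ) ^ 2)
    {U : ℂ → ℂ}
    (hU : ∀ w : ℂ, 1 < w.re → U w = χ.LFunction w /
        (χ.LFunction (w + betaJ c' D (j + 1)) * χ.LFunction (w + betaJ c' D (j + 2))) *
          xiSeries c' χ j d r w) :
    frakv2 c' χ j d r = (500 : ℂ) / (Real.log (bigP D) : ℂ) *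
      lineInt 1 (fun s =>
        χ.LFunction (1 + betaJ c' D (j + 1) + s) * χ.LFunction (1 + betaJ c' D (j + 2) + s) *
            U (1 + s) / χ.LFunction (1 + s) *
          (((Pp1 D : ℂ) ^ s - 2 * (Pp2 D : ℂ) ^ s + (Pp3 D : ℂ) ^ s) / ((d * r : ℕ) : ℂ) ^ s) /
          s ^ 2) := by
  have hP1 : 1 < bigP D := one_lt_bigP hD
  have hP0 : 0 < bigP D := by linarith
  have hdr : 0 < d * r := Nat.mul_pos hd hr
  have hy : 0 < ((d * r : ℕ) : ℝ) := by exact_mod_cast hdr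
  have hPp1 : 0 < Pp1 D := Real.rpow_pos_of_pos hP0 _
  have hPp2 : 0 < Pp2 D := Real.rpow_pos_of_pos hP0 _
  have hPp3 : 0 < Pp3 D := Real.rpow_pos_of_pos hP0 _
  have hX1 : 0 < Pp1 D / ((d * r : ℕ) : ℝ) := div_pos hPp1 hy
  have hX2 : 0 < Pp2 D / ((d * r : ℕ) : ℝ) := div_pos hPp2 hy
  have hX3 : 0 < Pp3 D / ((d * r : ℕ) : ℝ) := div_pos hPp3 hy
  set a : ℕ → ℂ := fun n => χ (n : ZMod D) * xiZero c' D j n d r with ha_def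
  -- on the line `Re s = 1` the typed integrand IS the Perron integrand of `lineInt_perron_comb`
  have hline : (fun t : ℝ => (fun s : ℂ =>
      χ.LFunction (1 + betaJ c' D (j + 1) + s) * χ.LFunction (1 + betaJ c' D (j + 2) + s) *
            U (1 + s) / χ.LFunction (1 + s) *
          (((Pp1 D : ℂ) ^ s - 2 * (Pp2 D : ℂ) ^ s + (Pp3 D : ℂ) ^ s) / ((d * r : ℕ) : ℂ) ^ s) /
          s ^ 2) (((1 : ℝ) : ℂ) + (t : ℂ) * I)) =
      fun t : ℝ => (fun s : ℂ => (∑' n : ℕ, a n / (n : ℂ) ^ (1 + s)) *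
        (perronPow (Pp1 D / ((d * r : ℕ) : ℝ)) 1 s - 2 * perronPow (Pp2 D / ((d * r : ℕ) : ℝ)) 1 s +
          perronPow (Pp3 D / ((d * r : ℕ) : ℝ)) 1 s)) (((1 : ℝ) : ℂ) + (t : ℂ) * I) := by
    funext t
    set s : ℂ := ((1 : ℝ) : ℂ) + (t : ℂ) * I with hs
    have hw : 1 < (1 + s).re := by simp [hs]
    have hne : ∀ w : ℂ, 1 < w.re → χ.LFunction w ≠ 0 := fun w hw' =>
      DirichletCharacter.LFunction_ne_zero_of_one_le_re χ (Or.inr (by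
        intro h; rw [h] at hw'; simp at hw')) hw'.le
    have hL0 : χ.LFunction (1 + s) ≠ 0 := hne _ hw
    have hL1 : χ.LFunction (1 + s + betaJ c' D (j + 1)) ≠ 0 :=
      hne _ (by rw [Complex.add_re, betaJ_re_eq_zero]; simpa using hw)
    have hL2 : χ.LFunction (1 + s + betaJ c' D (j + 2)) ≠ 0 :=
      hne _ (by rw [Complex.add_re, betaJ_re_eq_zero]; simpa using hw)
    -- the bracket `L·L·U/L` is the series
    have hbr : χ.LFunction (1 + betaJ c' D (j + 1) + s) * χ.LFunction (1 + betaJ c' D (j + 2) + s) *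
        U (1 + s) / χ.LFunction (1 + s) = ∑' n : ℕ, a n / (n : ℂ) ^ (1 + s) := by
      rw [hU _ hw, show (1 : ℂ) + betaJ c' D (j + 1) + s = 1 + s + betaJ c' D (j + 1) by ring,
        show (1 : ℂ) + betaJ c' D (j + 2) + s = 1 + s + betaJ c' D (j + 2) by ring]
      rw [show χ.LFunction (1 + s + betaJ c' D (j + 1)) * χ.LFunction (1 + s + betaJ c' D (j + 2)) *
          (χ.LFunction (1 + s) / (χ.LFunction (1 + s + betaJ c' D (j + 1)) *
            χ.LFunction (1 + s + betaJ c' D (j + 2))) * xiSeries c' χ j d r (1 + s)) /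
          χ.LFunction (1 + s) = xiSeries c' χ j d r (1 + s) by field_simp]
      rw [xiSeries]
      refine tsum_congr fun n => ?_
      rw [ha_def, Complex.cpow_neg, div_eq_mul_inv]
    -- the kernel is the combination of the three Perron kernels
    have hker : (((Pp1 D : ℂ) ^ s - 2 * (Pp2 D : ℂ) ^ s + (Pp3 D : ℂ) ^ s) / ((d * r : ℕ) : ℂ) ^ s) /
        s ^ 2 = perronPow (Pp1 D / ((d * r : ℕ) : ℝ)) 1 s - 2 * perronPow (Pp2 D / ((d * r : ℕ) : ℝ)) 1 s +
          perronPow (Pp3 D / ((d * r : ℕ) : ℝ)) 1 s := by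
      simp only [perronPow]
      rw [ofReal_div_natCast_cpow hPp1.le hdr s, ofReal_div_natCast_cpow hPp2.le hdr s,
        ofReal_div_natCast_cpow hPp3.le hdr s]
      ring
    simp only []
    rw [hbr, mul_div_assoc, hker]
  calc frakv2 c' χ j d r
      = (500 : ℂ) / (Real.log (bigP D) : ℂ) *
          ((∑ n ∈ Finset.Icc 1 ⌊Pp1 D / ((d * r : ℕ) : ℝ)⌋₊,
              a n / (n : ℂ) * ((Real.log (Pp1 D / ((d * r : ℕ) : ℝ) / n) : ℝ) : ℂ)) -
            2 * (∑ n ∈ Finset.Icc 1 ⌊Pp2 D / ((d * r : ℕ) : ℝ)⌋₊,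
              a n / (n : ℂ) * ((Real.log (Pp2 D / ((d * r : ℕ) : ℝ) / n) : ℝ) : ℂ)) +
            ∑ n ∈ Finset.Icc 1 ⌊Pp3 D / ((d * r : ℕ) : ℝ)⌋₊,
              a n / (n : ℂ) * ((Real.log (Pp3 D / ((d * r : ℕ) : ℝ) / n) : ℝ) : ℂ)) :=
        frakv2_eq_tent_sum c' χ hD j hd hr
    _ = (500 : ℂ) / (Real.log (bigP D) : ℂ) *
          lineInt 1 (fun s => (∑' n : ℕ, a n / (n : ℂ) ^ (1 + s)) *
            (perronPow (Pp1 D / ((d * r : ℕ) : ℝ)) 1 s - 2 * perronPow (Pp2 D / ((d * r : ℕ) : ℝ)) 1 s +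
              perronPow (Pp3 D / ((d * r : ℕ) : ℝ)) 1 s)) := by
        rw [lineInt_perron_comb hξ hX1 hX2 hX3]
    _ = _ := by
        rw [lineInt, lineInt, hline]

/-- **`Z22:§10.u018` ⇐ the absolute convergence of `Σ_nχ(n)ξ₀ⱼ(n;d,r)n^{−s}` on `Re s = 2`**:
if, for all large `D` (real primitive `χ`), every `j ∈ {1,2,3}` and `d, r ≥ 1`,
`Σ_n |χ(n)ξ₀ⱼ(n;d,r)|/n² < ∞`, then the typed node `Step10u018 c′` holds (the display's only
non-formal input; cf. the tree's `Section8PerronSteps.eq89` for (8.9), stated under the same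
hypothesis). [cite: Zhang2022LandauSiegel, §10 proof of Lemma 10.2 p. 55, tex L2824] -/
theorem step10u018_of_summable (c' : ℝ)
    (hsum : ForAllLarge fun D _ χ => ∀ j ∈ ({1, 2, 3} : Finset ℕ), ∀ d r : ℕ, 1 ≤ d → 1 ≤ r →
      Summable fun n : ℕ => ‖χ (n : ZMod D) * xiZero c' D j n d r‖ / (n : ℝ) ^ 2) :
    Step10u018 c' := by
  obtain ⟨D₀, h⟩ := hsum
  refine ⟨max D₀ 2, fun D _ χ hD hq hp => ?_⟩
  intro _ j hj d r hd hr _ U hU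
  exact frakv2_eq_lineInt c' χ (le_trans (le_max_right _ _) hD) hd hr
    (h D χ (le_trans (le_max_left _ _) hD) hq hp j hj d r hd hr) hU

/-- The pointwise form of the same edge, for ONE modulus: the absolute convergence for the given
`χ, j, d, r` yields the `Step10u018`-clause for them (no largeness beyond `D ≥ 2`, no (A), no range).
[cite: Zhang2022LandauSiegel, §10 proof of Lemma 10.2 p. 55, tex L2824] -/
theorem step10u018_clause (c' : ℝ) {D : ℕ} [NeZero D] (χ : DirichletCharacter ℂ D) (hD : 2 ≤ D)
    {j d r : ℕ} (hd : 1 ≤ d) (hr : 1 ≤ r)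
    (hξ : Summable fun n : ℕ => ‖χ (n : ZMod D) * xiZero c' D j n d r‖ / (n : ℝ) ^ 2) :
    ∀ U : ℂ → ℂ,
      (∀ w : ℂ, 1 < w.re → U w = χ.LFunction w /
          (χ.LFunction (w + betaJ c' D (j + 1)) * χ.LFunction (w + betaJ c' D (j + 2))) *
            xiSeries c' χ j d r w) →
      frakv2 c' χ j d r = (500 : ℂ) / (Real.log (bigP D) : ℂ) *
        lineInt 1 (fun s =>
          χ.LFunction (1 + betaJ c' D (j + 1) + s) * χ.LFunction (1 + betaJ c' D (j + 2) + s) *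
              U (1 + s) / χ.LFunction (1 + s) *
            (((Pp1 D : ℂ) ^ s - 2 * (Pp2 D : ℂ) ^ s + (Pp3 D : ℂ) ^ s) / ((d * r : ℕ) : ℂ) ^ s) /
            s ^ 2) :=
  fun _ hU => frakv2_eq_lineInt c' χ hD hd hr hξ hU

end Literature.NumberTheory.LFunctions.Zhang2022.Typed.Sec10A
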